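import Summits.CriticalPhenomena.SAWScalingLimit.Theorems.MassRatio.Negative.Walks

/-!
# Crux `MassRatio` (stmt-CriticalPhenomena-8550) — load-bearing hypotheses, part 3: the Dobrushin domain `D₀ = (-2,2)×(-1,1)` marked at `-1-i`, `1-i` (flat at `b` with `ρ = 1`) and the mesh parameters `mRow, MRow, PPos, pA, pB, iK` with their inequalities (`params`)

Negative knowledge on the crux `MassRatio` (stmt-CriticalPhenomena-8550, route SAWDefectDecoherence r3),
written by the standing disprover (cdisprove, cycles 1–4). The series `MassRatio/Negative/*` does NOT
refute the crux (verdict: RESISTS — it is a pure exponent bet, predicted ratio `δ^{-25/48}` against the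
cut `δ^{-3/4}`); it proves which hypotheses of the crux are LOAD-BEARING (rows clause, `0 < ρ`,
`δ·mid(b_δ) → b`, exhaustion of compacts: each deleted ⇒ FALSE, by explicit admissible families in the
rectangle `D₀ = (-2,2)×(-1,1)` whose boundary mass at the target edge is starved EXACTLY by a bare
corridor), that the hypothesis frame is satisfiable (`massRatio_frame_nonvacuous`), and that the
`Nonempty`-SAW clause is implied by the others. Mechanism throughout: on a bare root-attached corridor
the self-avoiding walk is unique, so `|Z| = x_c^{length}` exactly, while a staircase walk certifies
`|Z(e₀)| ≥ x_c^{2 iK + 1}` at a mid-edge `e₀` of the compact `Kbox`; `x_c < 3/5` and Bernoulli finish.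
-/

namespace Summit.CriticalPhenomena.SAWScalingLimit.Theorems.MassRatio.Negative

open Literature.Probability.LatticeModels Literature.Probability.RandomPlanarGeometry.SAW
open Literature.Probability.RandomPlanarGeometry
open Summit.CriticalPhenomena.SAWScalingLimit.Theses.SAWDefectDecoherence

/-! ### The Dobrushin domain: the rectangle `(-2,2)×(-1,1)` marked at `-1 - i` and `1 - i` -/

/-- The rectangle `(-2, 2) × (-1, 1)` with marked points `a = -1 - i` (mark `1/16`) and
`b = 1 - i` (mark `3/16`), both on the bottom side; the boundary is flat (horizontal, domain above)
in the ball of radius `1` about `b`. [folklore] -/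
noncomputable def D₀ : DobrushinDomain where
  toJordanDomain := rectDomain 2 1 two_pos one_pos
  mark := ![1 / 16, 3 / 16]
  strictMono_mark := by
    refine Fin.strictMono_iff_lt_succ.2 fun k => ?_
    fin_cases k
    simp
    norm_num
  mark_mem k := by fin_cases k <;> simp <;> norm_num

/-- `D₀_carrier`: mesh-parameter bookkeeping for the domain `D₀` (MassRatio negative series). [folklore] -/
theorem D₀_carrier : D₀.carrier = symRect 2 1 := rfl

/-- `mem_D₀_carrier`: mesh-parameter bookkeeping for the domain `D₀` (MassRatio negative series). [folklore] -/
theorem mem_D₀_carrier {z : ℂ} : z ∈ D₀.carrier ↔ (-2 < z.re ∧ z.re < 2) ∧ (-1 < z.im ∧ z.im < 1) :=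
  mem_symRect

/-- `D₀_pt0`: mesh-parameter bookkeeping for the domain `D₀` (MassRatio negative series). [folklore] -/
theorem D₀_pt0 : D₀.pt 0 = ⟨-1, -1⟩ := by
  show polygonLoop (rectVerts 2 1) (1 / 16) = _
  have h := polygonLoop_apply_div (l := rectVerts 2 1) (k := 0) (by simp) (θ := 1 / 4)
    ⟨by norm_num, by norm_num⟩
  rw [show ((0 : ℕ) + 1 / 4 : ℝ) / (rectVerts 2 1).length = 1 / 16 by simp; norm_num] at h
  rw [h]
  apply Complex.ext <;> simp [rectVerts, AffineMap.lineMap_apply_module']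
  norm_num

/-- `D₀_pt1`: mesh-parameter bookkeeping for the domain `D₀` (MassRatio negative series). [folklore] -/
theorem D₀_pt1 : D₀.pt 1 = ⟨1, -1⟩ := by
  show polygonLoop (rectVerts 2 1) (3 / 16) = _
  have h := polygonLoop_apply_div (l := rectVerts 2 1) (k := 0) (by simp) (θ := 3 / 4)
    ⟨by norm_num, by norm_num⟩
  rw [show ((0 : ℕ) + 3 / 4 : ℝ) / (rectVerts 2 1).length = 3 / 16 by simp; norm_num] at h
  rw [h]
  apply Complex.ext <;> simp [rectVerts, AffineMap.lineMap_apply_module']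
  norm_num

/-- The boundary of `D₀` is flat near `b = 1 - i`: within the unit ball about `b` the domain is
the upper half-plane `Im z > -1`. [folklore] -/
theorem D₀_flat : D₀.carrier ∩ Metric.ball (D₀.pt 1) 1 =
    {z : ℂ | (D₀.pt 1).im < z.im} ∩ Metric.ball (D₀.pt 1) 1 := by
  ext z
  simp only [Set.mem_inter_iff, mem_D₀_carrier, Set.mem_setOf_eq, D₀_pt1, Metric.mem_ball]
  constructor
  · rintro ⟨⟨-, h3, -⟩, hz⟩; exact ⟨h3, hz⟩
  · rintro ⟨h3, hz⟩
    have hre : |z.re - 1| < 1 := by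
      have := Complex.abs_re_le_norm (z - ⟨1, -1⟩)
      rw [Complex.dist_eq] at hz
      simp at this; linarith
    have him : |z.im + 1| < 1 := by
      have := Complex.abs_im_le_norm (z - ⟨1, -1⟩)
      rw [Complex.dist_eq] at hz
      simp at this; linarith
    rw [abs_lt] at hre him
    exact ⟨⟨⟨by linarith, by linarith⟩, h3, by linarith⟩, hz⟩

/-! ### Mesh parameters -/

/-- The row height unit `√3/2` of the honeycomb lattice. [folklore] -/
noncomputable def hgt : ℝ := Real.sqrt 3 / 2

/-- `hgt_pos`: mesh-parameter bookkeeping for the domain `D₀` (MassRatio negative series). [folklore] -/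
theorem hgt_pos : 0 < hgt := by unfold hgt; positivity

/-- `sqrt3_gt`: mesh-parameter bookkeeping for the domain `D₀` (MassRatio negative series). [folklore] -/
theorem sqrt3_gt : (17 : ℝ) / 10 < Real.sqrt 3 := by
  rw [show (17:ℝ)/10 = Real.sqrt ((17/10)^2) by rw [Real.sqrt_sq]; norm_num]
  exact Real.sqrt_lt_sqrt (by norm_num) (by norm_num)

/-- `sqrt3_lt`: mesh-parameter bookkeeping for the domain `D₀` (MassRatio negative series). [folklore] -/
theorem sqrt3_lt : Real.sqrt 3 < (7 : ℝ) / 4 := by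
  rw [show (7:ℝ)/4 = Real.sqrt ((7/4)^2) by rw [Real.sqrt_sq]; norm_num]
  exact Real.sqrt_lt_sqrt (by norm_num) (by norm_num)

/-- `hgt_gt`: mesh-parameter bookkeeping for the domain `D₀` (MassRatio negative series). [folklore] -/
theorem hgt_gt : (17 : ℝ) / 20 < hgt := by unfold hgt; linarith [sqrt3_gt]
/-- `hgt_lt`: mesh-parameter bookkeeping for the domain `D₀` (MassRatio negative series). [folklore] -/
theorem hgt_lt : hgt < 7 / 8 := by unfold hgt; linarith [sqrt3_lt]

/-- bottom row of the discretisation: least `r` with `δ·hgt·(r + 1/3) > -1` [folklore] -/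
noncomputable def mRow (δ : ℝ) : ℤ := ⌊-(1 / (δ * hgt)) - 1 / 3⌋ + 1
/-- top row: largest `r` with `δ·hgt·(r + 2/3) < 1` [folklore] -/
noncomputable def MRow (δ : ℝ) : ℤ := ⌈1 / (δ * hgt) - 2 / 3⌉ - 1
/-- largest position with `δ (p+1)/2 < 2` [folklore] -/
noncomputable def PPos (δ : ℝ) : ℤ := ⌈4 * (1 / δ) - 1⌉ - 1
/-- position of the root mid-edge `a_δ` (near `Re = -1`), of the parity of the bottom row [folklore] -/
noncomputable def pA (δ : ℝ) : ℤ := 2 * ⌊(-(2 * (1 / δ)) - 1 - mRow δ) / 2⌋ + mRow δ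
/-- position of the far mid-edge `b_δ` (near `Re = 1`), of the parity of the bottom row [folklore] -/
noncomputable def pB (δ : ℝ) : ℤ := 2 * ⌊(2 * (1 / δ) - 1 - mRow δ) / 2⌋ + mRow δ
/-- number of rows climbed by the comparison walk into `K` (height `2/5` above the bottom) [folklore] -/
noncomputable def iK (δ : ℝ) : ℕ := ⌊2 * (1 / (δ * hgt)) / 5⌋₊

section Params

variable {δ : ℝ}

/-- `t_mul`: mesh-parameter bookkeeping for the domain `D₀` (MassRatio negative series). [folklore] -/
theorem t_mul (hδ : 0 < δ) : δ * hgt * (1 / (δ * hgt)) = 1 := by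
  have := hgt_pos.ne'; field_simp

/-- `s_mul`: mesh-parameter bookkeeping for the domain `D₀` (MassRatio negative series). [folklore] -/
theorem s_mul (hδ : 0 < δ) : δ * (1 / δ) = 1 := by field_simp

/-- `s_eq`: mesh-parameter bookkeeping for the domain `D₀` (MassRatio negative series). [folklore] -/
theorem s_eq (hδ : 0 < δ) : 1 / δ = hgt * (1 / (δ * hgt)) := by
  have := hgt_pos.ne'; field_simp

/-- `t_ge`: mesh-parameter bookkeeping for the domain `D₀` (MassRatio negative series). [folklore] -/
theorem t_ge (hδ : 0 < δ) (hδ1 : δ ≤ 1 / 100) : 100 ≤ 1 / (δ * hgt) := by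
  have h1 := hgt_pos
  have h2 := hgt_lt
  rw [le_div_iff₀ (by positivity)]
  nlinarith

/-- `mRow_le`: mesh-parameter bookkeeping for the domain `D₀` (MassRatio negative series). [folklore] -/
theorem mRow_le (δ : ℝ) : (mRow δ : ℝ) ≤ -(1 / (δ * hgt)) + 2 / 3 := by
  have := Int.floor_le (-(1 / (δ * hgt)) - 1 / 3)
  unfold mRow; push_cast; linarith

/-- `lt_mRow`: mesh-parameter bookkeeping for the domain `D₀` (MassRatio negative series). [folklore] -/
theorem lt_mRow (δ : ℝ) : -(1 / (δ * hgt)) - 1 / 3 < mRow δ := by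
  have := Int.lt_floor_add_one (-(1 / (δ * hgt)) - 1 / 3)
  unfold mRow; push_cast; linarith

/-- `le_MRow`: mesh-parameter bookkeeping for the domain `D₀` (MassRatio negative series). [folklore] -/
theorem le_MRow (δ : ℝ) : 1 / (δ * hgt) - 5 / 3 ≤ MRow δ := by
  have := Int.le_ceil (1 / (δ * hgt) - 2 / 3)
  unfold MRow; push_cast; linarith

/-- `MRow_lt`: mesh-parameter bookkeeping for the domain `D₀` (MassRatio negative series). [folklore] -/
theorem MRow_lt (δ : ℝ) : (MRow δ : ℝ) < 1 / (δ * hgt) - 2 / 3 := by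
  have := Int.ceil_lt_add_one (1 / (δ * hgt) - 2 / 3)
  unfold MRow; push_cast; linarith

/-- `le_PPos`: mesh-parameter bookkeeping for the domain `D₀` (MassRatio negative series). [folklore] -/
theorem le_PPos (δ : ℝ) : 4 * (1 / δ) - 2 ≤ PPos δ := by
  have := Int.le_ceil (4 * (1 / δ) - 1)
  unfold PPos; push_cast; linarith

/-- `PPos_lt`: mesh-parameter bookkeeping for the domain `D₀` (MassRatio negative series). [folklore] -/
theorem PPos_lt (δ : ℝ) : (PPos δ : ℝ) < 4 * (1 / δ) - 1 := by
  have := Int.ceil_lt_add_one (4 * (1 / δ) - 1)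
  unfold PPos; push_cast; linarith

/-- `pA_le`: mesh-parameter bookkeeping for the domain `D₀` (MassRatio negative series). [folklore] -/
theorem pA_le (δ : ℝ) : (pA δ : ℝ) ≤ -(2 * (1 / δ)) - 1 := by
  have := Int.floor_le ((-(2 * (1 / δ)) - 1 - mRow δ) / 2)
  unfold pA; push_cast; linarith

/-- `lt_pA`: mesh-parameter bookkeeping for the domain `D₀` (MassRatio negative series). [folklore] -/
theorem lt_pA (δ : ℝ) : -(2 * (1 / δ)) - 3 < pA δ := by
  have := Int.lt_floor_add_one ((-(2 * (1 / δ)) - 1 - mRow δ) / 2)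
  unfold pA; push_cast; linarith

/-- `pA_mod`: mesh-parameter bookkeeping for the domain `D₀` (MassRatio negative series). [folklore] -/
theorem pA_mod (δ : ℝ) : (pA δ - mRow δ) % 2 = 0 := by
  unfold pA; omega

/-- `pB_le`: mesh-parameter bookkeeping for the domain `D₀` (MassRatio negative series). [folklore] -/
theorem pB_le (δ : ℝ) : (pB δ : ℝ) ≤ 2 * (1 / δ) - 1 := by
  have := Int.floor_le ((2 * (1 / δ) - 1 - mRow δ) / 2)
  unfold pB; push_cast; linarith

/-- `lt_pB`: mesh-parameter bookkeeping for the domain `D₀` (MassRatio negative series). [folklore] -/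
theorem lt_pB (δ : ℝ) : 2 * (1 / δ) - 3 < pB δ := by
  have := Int.lt_floor_add_one ((2 * (1 / δ) - 1 - mRow δ) / 2)
  unfold pB; push_cast; linarith

/-- `pB_mod`: mesh-parameter bookkeeping for the domain `D₀` (MassRatio negative series). [folklore] -/
theorem pB_mod (δ : ℝ) : (pB δ - mRow δ) % 2 = 0 := by
  unfold pB; omega

/-- `iK_le'`: mesh-parameter bookkeeping for the domain `D₀` (MassRatio negative series). [folklore] -/
theorem iK_le' (hδ : 0 < δ) : (iK δ : ℝ) ≤ 2 * (1 / (δ * hgt)) / 5 := by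
  have h := Nat.floor_le (show (0:ℝ) ≤ 2 * (1 / (δ * hgt)) / 5 by have := hgt_pos; positivity)
  unfold iK; exact h

/-- `lt_iK'`: mesh-parameter bookkeeping for the domain `D₀` (MassRatio negative series). [folklore] -/
theorem lt_iK' (δ : ℝ) : 2 * (1 / (δ * hgt)) / 5 - 1 < (iK δ : ℝ) := by
  have h := Nat.lt_floor_add_one (2 * (1 / (δ * hgt)) / 5)
  unfold iK; linarith

/-- `iK_le`: mesh-parameter bookkeeping for the domain `D₀` (MassRatio negative series). [folklore] -/
theorem iK_le (hδ : 0 < δ) : δ * hgt * (iK δ) ≤ 2 / 5 := by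
  have h := iK_le' hδ
  have hp : 0 < δ * hgt := by have := hgt_pos; positivity
  have ht := t_mul hδ
  nlinarith

/-- `lt_iK`: mesh-parameter bookkeeping for the domain `D₀` (MassRatio negative series). [folklore] -/
theorem lt_iK (hδ : 0 < δ) : 2 / 5 - δ * hgt < δ * hgt * (iK δ) := by
  have h := lt_iK' δ
  have hp : 0 < δ * hgt := by have := hgt_pos; positivity
  have ht := t_mul hδ
  nlinarith

/-- bottom heights: rows `≥ m` lie above `Im = -1` after scaling [folklore] -/
theorem mRow_height (hδ : 0 < δ) : -1 < δ * hgt * ((mRow δ : ℝ) + 1 / 3) := by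
  have h := lt_mRow δ
  have hp : 0 < δ * hgt := by have := hgt_pos; positivity
  have ht := t_mul hδ
  nlinarith

/-- `mRow_height'`: mesh-parameter bookkeeping for the domain `D₀` (MassRatio negative series). [folklore] -/
theorem mRow_height' (hδ : 0 < δ) : δ * hgt * ((mRow δ : ℝ) - 2 / 3) ≤ -1 := by
  have h := mRow_le δ
  have hp : 0 < δ * hgt := by have := hgt_pos; positivity
  have ht := t_mul hδ
  nlinarith

/-- `MRow_height`: mesh-parameter bookkeeping for the domain `D₀` (MassRatio negative series). [folklore] -/
theorem MRow_height (hδ : 0 < δ) : δ * hgt * ((MRow δ : ℝ) + 2 / 3) < 1 := by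
  have h := MRow_lt δ
  have hp : 0 < δ * hgt := by have := hgt_pos; positivity
  have ht := t_mul hδ
  nlinarith

/-- `PPos_width`: mesh-parameter bookkeeping for the domain `D₀` (MassRatio negative series). [folklore] -/
theorem PPos_width (hδ : 0 < δ) : δ * ((PPos δ : ℝ) + 1) / 2 < 2 := by
  have h := PPos_lt δ
  have := s_mul hδ
  nlinarith

/-- `PPos_width'`: mesh-parameter bookkeeping for the domain `D₀` (MassRatio negative series). [folklore] -/
theorem PPos_width' (hδ : 0 < δ) : -2 < δ * (-(PPos δ : ℝ) + 1) / 2 := by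
  have h := PPos_lt δ
  have := s_mul hδ
  nlinarith

/-- `pA_re`: mesh-parameter bookkeeping for the domain `D₀` (MassRatio negative series). [folklore] -/
theorem pA_re (hδ : 0 < δ) :
    δ * ((pA δ : ℝ) + 1) / 2 ≤ -1 ∧ -1 - δ < δ * ((pA δ : ℝ) + 1) / 2 := by
  have h1 := pA_le δ
  have h2 := lt_pA δ
  have := s_mul hδ
  constructor <;> nlinarith

/-- `pB_re`: mesh-parameter bookkeeping for the domain `D₀` (MassRatio negative series). [folklore] -/
theorem pB_re (hδ : 0 < δ) :
    δ * ((pB δ : ℝ) + 1) / 2 ≤ 1 ∧ 1 - δ < δ * ((pB δ : ℝ) + 1) / 2 := by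
  have h1 := pB_le δ
  have h2 := lt_pB δ
  have := s_mul hδ
  constructor <;> nlinarith

/-- All the integer inequalities between the parameters used below, for `0 < δ ≤ 1/100`. [folklore] -/
theorem params (hδ : 0 < δ) (hδ1 : δ ≤ 1 / 100) :
    mRow δ + 3 + (iK δ : ℤ) + 1 ≤ MRow δ ∧ 0 ≤ MRow δ ∧ mRow δ ≤ -10 ∧
    -PPos δ ≤ pA δ - (iK δ : ℤ) - 4 ∧ pA δ ≤ -10 ∧ 10 ≤ pB δ ∧ pB δ ≤ PPos δ ∧
    (100 : ℤ) ≤ PPos δ ∧ ((4 * (iK δ / 2) + 2 * iK δ : ℕ) : ℤ) ≤ pB δ - pA δ - 1 ∧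
    ((4 * (iK δ / 2) + 2 * iK δ : ℕ) : ℤ) ≤ -6 - pA δ ∧ 1 / (6 * δ) ≤ ((iK δ / 2 : ℕ) : ℝ) := by
  have ht := t_ge hδ hδ1
  have hs := s_eq hδ
  set t := 1 / (δ * hgt) with ht_def
  set s := 1 / δ with hs_def
  have hg1 := hgt_gt
  have hg2 := hgt_lt
  have h1 := mRow_le δ
  have h2 := lt_mRow δ
  have h3 := le_MRow δ
  have h4 := MRow_lt δ
  have h5 := le_PPos δ
  have h6 := PPos_lt δ
  have h7 := pA_le δ
  have h8 := lt_pA δ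
  have h9 := pB_le δ
  have h10 := lt_pB δ
  have h11 := iK_le' hδ
  have h12 := lt_iK' δ
  simp only [← ht_def, ← hs_def] at h1 h2 h3 h4 h5 h6 h7 h8 h9 h10 h11 h12
  have hik0 : (0:ℝ) ≤ (iK δ : ℝ) := by positivity
  have hdiv1 : (iK δ : ℝ) ≤ 2 * ((iK δ / 2 : ℕ) : ℝ) + 1 := by
    have : iK δ ≤ 2 * (iK δ / 2) + 1 := by omega
    exact_mod_cast this
  have hdiv2 : 2 * ((iK δ / 2 : ℕ) : ℝ) ≤ (iK δ : ℝ) := by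
    have : 2 * (iK δ / 2) ≤ iK δ := by omega
    exact_mod_cast this
  refine ⟨?_, ?_, ?_, ?_, ?_, ?_, ?_, ?_, ?_, ?_, ?_⟩
  · have : (mRow δ : ℝ) + 3 + (iK δ : ℝ) + 1 ≤ MRow δ := by nlinarith
    exact_mod_cast this
  · have : (0 : ℝ) ≤ MRow δ := by nlinarith
    exact_mod_cast this
  · have : (mRow δ : ℝ) ≤ -10 := by nlinarith
    exact_mod_cast this
  · have : -(PPos δ : ℝ) ≤ pA δ - (iK δ : ℝ) - 4 := by nlinarith
    exact_mod_cast this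
  · have : (pA δ : ℝ) ≤ -10 := by nlinarith
    exact_mod_cast this
  · have : (10 : ℝ) ≤ pB δ := by nlinarith
    exact_mod_cast this
  · have : (pB δ : ℝ) ≤ PPos δ := by nlinarith
    exact_mod_cast this
  · have : (100 : ℝ) ≤ PPos δ := by nlinarith
    exact_mod_cast this
  · have : ((4 * (iK δ / 2) + 2 * iK δ : ℕ) : ℝ) ≤ ((pB δ - pA δ - 1 : ℤ) : ℝ) := by
      push_cast; nlinarith
    exact (Int.cast_le (R := ℝ)).1 (by rw [Int.cast_natCast]; exact this)
  · have : ((4 * (iK δ / 2) + 2 * iK δ : ℕ) : ℝ) ≤ ((-6 - pA δ : ℤ) : ℝ) := by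
      push_cast; nlinarith
    exact (Int.cast_le (R := ℝ)).1 (by rw [Int.cast_natCast]; exact this)
  · have : 1 / (6 * δ) = s / 6 := by rw [hs_def]; ring
    rw [this]; nlinarith

end Params

end Summit.CriticalPhenomena.SAWScalingLimit.Theorems.MassRatio.Negative
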